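import Literature.Topology.FourManifolds.BandRebuildCurve
import Literature.Topology.FourManifolds.SchoenfliesIsotopy
import HarnessLib

/-!
# Schubert's theorem in normal position, reduced to rebuilt presentations

Topic `Literature/Topology/FourManifolds` (trunk T-4MAN). Fact seat
`provefact-Literature.Topology.FourManifolds.Knot.IsConnectedSum.isIsotopic` (`BandSum.lean`:
the connected sum of oriented knots is well defined up to isotopy; H. Schubert (1949)). State of
the decomposition:

* `Knot.IsConnectedSum.isIsotopic_of_ball_of_normalPosition` (`SchoenfliesIsotopy.lean`):
  `isIsotopic` follows from the ball form of the smooth Schoenflies theorem in `𝕊³`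
  (`SphereEmbedding.schoenflies_exists_ball`, Alexander (1924)) and Schubert's theorem for
  presentations in normal position, `Literature.Topology.FourManifolds.Knot.Schubert1949_normalPosition`
  (`ConnectedSumNormalForm.lean`).

This file performs the next reduction. A presentation `b : BandData A B K ∅` in normal position
has arbitrary (`C^∞`, embedded) attaching arcs in the open collar and a band map about which
nothing is known at the frontier of the collar (cf. the discussion in
`BandSumIsotopyRegular.lean`). The files `BandRebuildArches.lean`, `BandRebuildCurve.lean`
construct from `b` an explicit knot `b.rebuild hAB` — `A` and `B` joined by two *standard* arches
which only involve the band over the closed sub-rectangle `[0, 1] × [1/10, 9/10]` of the collar,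
where it is an embedding. Here:

## Part V: the rebuilt knot is a band sum along the same band

* `Literature.Topology.FourManifolds.BandData.rebuildData` — a presentation `BandData A B (b.rebuild hAB) ∅` along the **same
  band map with the same collar width**, with the standard arcs `b.loArc`, `b.upArc`; the
  verification of the clauses is a computation of `range (b.rebuild hAB)` against the band
  (points of the rebuilt knot are points of `A` with parameters `[ahi, alo + 1]`, points of `B`
  with parameters `[thetaB (1/5), thetaB (4/5) + 1]`, or band points of the two arches);
* `Literature.Topology.FourManifolds.BandData.isIsotopic_rebuild` — hence `K` is isotopic to `b.rebuild hAB` as soon as band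
  sums depend only on the band (`BandData.isIsotopic_of_band_eq`, named fact of `BandSum.lean`).

## Part VI: the reduction

* `Literature.Topology.FourManifolds.Knot.Schubert1949_normalPosition_rebuilt` (named fact, the remaining heart): Schubert's
  theorem for two **rebuilt** presentations with the same summands `A` (north), `B` (south);
* `Literature.Topology.FourManifolds.Knot.Schubert1949_normalPosition_of_rebuilt` (proved): the tree's
  `Schubert1949_normalPosition` follows from the rebuilt case and `BandData.isIsotopic_of_band_eq`;
* `Literature.Topology.FourManifolds.Knot.IsConnectedSum.isIsotopic_of_ball_of_band_eq_of_rebuilt` (proved): the assembled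
  reduction of `IsConnectedSum.isIsotopic` to the three named facts
  `schoenflies_exists_ball`, `BandData.isIsotopic_of_band_eq`, `Schubert1949_normalPosition_rebuilt`.

## References

* P. R. Cromwell, *Knots and Links*, Cambridge University Press (2004), §4.6, Thm. 4.6.1
  (held: `book:cromwell2004-knots-links`, PDF p. 69). [Cromwell2004]
* H. Schubert, *Die eindeutige Zerlegbarkeit eines Knotens in Primknoten*, S.-B. Heidelberger
  Akad. Wiss. Math.-Nat. Kl. 1949, no. 3, 57–104 (not held). [Schubert1949]
* R. E. Gompf, A. I. Stipsicz, *4-Manifolds and Kirby Calculus*, GSM 20, AMS (1999), §5.1.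
  [GompfStipsicz1999]
-/

open scoped Manifold ContDiff Topology Real
open Function Set Metric

noncomputable section

namespace Literature.Topology.FourManifolds

/-- Local notation: `𝔼 n` is the model Euclidean space `EuclideanSpace ℝ (Fin n)`. -/
local notation "𝔼 " n:arg => EuclideanSpace ℝ (Fin n)

/-- Local notation: `𝕊 n` is the unit sphere in `EuclideanSpace ℝ (Fin (n + 1))`. -/
local notation "𝕊 " n:arg => (Metric.sphere (0 : EuclideanSpace ℝ (Fin (n + 1))) 1)

/-- Every point of the circle is `circlePt s` for some `s`. [folklore] -/
theorem exists_circlePt_eq (p : 𝕊 1) : ∃ s : ℝ, circlePt s = p := by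
  obtain ⟨θ, rfl⟩ := circlePoint_surjective p
  refine ⟨(2 * π)⁻¹ * θ, ?_⟩
  rw [circlePt_eq_circlePoint, ← mul_assoc, mul_inv_cancel₀ (by positivity : (2 * π : ℝ) ≠ 0), one_mul]

namespace BandData

variable {A B K : Knot} {avoid : Set (𝕊 3)} (b : BandData A B K avoid)

/-! ### Points of the rebuilt knot -/

/-- Membership in the range of the rebuilt knot, read through the piece function. [folklore] -/
theorem mem_range_rebuild_iff (hAB : Disjoint (range A) (range B)) {p : 𝕊 3} :
    p ∈ range (b.rebuild hAB) ↔ ∃ s ∈ Ico b.alo (b.alo + 1), b.pieceFun s = (p : 𝔼 4) := by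
  have h := b.image_coe_range_rebuild hAB
  constructor
  · intro hp
    have : (p : 𝔼 4) ∈ (Subtype.val : (𝕊 3) → 𝔼 4) '' range (b.rebuild hAB) := ⟨p, hp, rfl⟩
    rw [h] at this
    exact this
  · rintro hp
    have : (p : 𝔼 4) ∈ (Subtype.val : (𝕊 3) → 𝔼 4) '' range (b.rebuild hAB) := by rw [h]; exact hp
    obtain ⟨q, hq, hqp⟩ := this
    rwa [← Subtype.ext hqp]

/-- Near a parameter of the lower arch region the rebuilt curve is `band ∘ cLo`. [folklore] -/
theorem rebuildCurve_eventuallyEq_lo {t₀ : ℝ} (h : t₀ ∈ Ioo b.alo b.tlo) :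
    b.rebuildCurve =ᶠ[𝓝 t₀] fun t ↦ ((b.band (b.cLo t) : 𝕊 3) : 𝔼 4) := by
  have hm := b.marks_lt
  filter_upwards [isOpen_Ioo.mem_nhds h] with t ht
  rw [rebuildCurve, b.red_eq_sub (n := 0) (by simpa using ⟨ht.1.le, by linarith [ht.2]⟩), Int.cast_zero,
    sub_zero, b.pieceFun_of_lt_tlo ht.2]

/-- Points of `A` with parameter in `[ahi, alo + 1]` lie on the rebuilt knot. [folklore] -/
theorem apply_A_mem_range_rebuild (hAB : Disjoint (range A) (range B)) {s : ℝ}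
    (hs : s ∈ Icc b.ahi (b.alo + 1)) : A (circlePt s) ∈ range (b.rebuild hAB) := by
  have hm := b.marks_lt
  rw [b.mem_range_rebuild_iff hAB]
  rcases hs.2.lt_or_eq with h | h
  · exact ⟨s, ⟨by linarith [hs.1], h⟩, by rw [b.pieceFun_of_ahi_le hs.1, Knot.curve_apply]⟩
  · refine ⟨b.alo, ⟨le_rfl, by linarith⟩, ?_⟩
    rw [b.pieceFun_typeA ⟨le_rfl, by linarith⟩ (Or.inl (by linarith [b.epsLo_bounds.1])), Knot.curve_apply,
      h, circlePt_add_one]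

/-- Points of `B` with parameter in `[thetaB (1/5), thetaB (4/5) + 1]` lie on the rebuilt knot.
[folklore] -/
theorem apply_B_mem_range_rebuild (hAB : Disjoint (range A) (range B)) {s : ℝ}
    (hs : s ∈ Icc (b.thetaB (1 / 5)) (b.thetaB (4 / 5) + 1)) : B (circlePt s) ∈ range (b.rebuild hAB) := by
  have hm := b.marks_lt
  obtain ⟨hε, -, -⟩ := b.epsLo_bounds
  obtain ⟨hε', -, -⟩ := b.epsHi_bounds
  rw [b.mem_range_rebuild_iff hAB]
  have h1 : b.tlo ≤ b.psiInv s := by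
    rw [← b.psiInv_psi b.tlo, psi_tlo]; exact b.strictMono_psiInv.monotone hs.1
  have h2 : b.psiInv s ≤ b.thi := by
    rw [← b.psiInv_psi b.thi, psi_thi]; exact b.strictMono_psiInv.monotone hs.2
  refine ⟨b.psiInv s, ⟨by linarith, by linarith⟩, ?_⟩
  rw [b.pieceFun_typeB ⟨by linarith, by linarith⟩, psi_psiInv, Knot.curve_apply]

/-- Reduction of a real number into a window `[a, a + 1)`. [folklore] -/
theorem exists_reduce (a x : ℝ) : ∃ (y : ℝ) (m : ℤ), y ∈ Ico a (a + 1) ∧ x = y + m :=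
  ⟨toIcoMod zero_lt_one a x, toIcoDiv zero_lt_one a x, toIcoMod_mem_Ico _ _ _, by
    have := self_sub_toIcoDiv_zsmul zero_lt_one a x
    rw [zsmul_eq_mul, mul_one] at this
    linarith⟩

/-- **Points of the band on the left edge at height `≤ 1/5` or `≥ 4/5` lie on the rebuilt knot.**
[folklore] -/
theorem band_pt2_zero_mem_range_rebuild (hAB : Disjoint (range A) (range B)) {y : ℝ}
    (hy : y ∈ Ioo (-b.δ) (1 + b.δ)) (h : y ≤ 1 / 5 ∨ 4 / 5 ≤ y) :
    b.band (pt2 0 y) ∈ range (b.rebuild hAB) := by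
  have hm := b.marks_lt
  have hmono := b.strictMonoOn_thetaA.monotoneOn
  by_cases hw : y ∈ Icc (10⁻¹ : ℝ) (9 / 10)
  · rw [← b.apply_circlePt_thetaA hw]
    rcases h with h | h
    · rw [← circlePt_add_one]
      apply b.apply_A_mem_range_rebuild hAB
      constructor
      · have : b.thetaA 10⁻¹ ≤ b.thetaA y := hmono (by norm_num) hw hw.1
        linarith
      · have : b.thetaA y ≤ b.alo := hmono hw (by norm_num) h
        linarith
    · apply b.apply_A_mem_range_rebuild hAB
      exact ⟨hmono (by norm_num) hw h, by linarith [hmono hw (by norm_num) hw.2]⟩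
  · -- off the lift window: the point of `A` has reduced parameter in `[ahi, alo + 1)`
    obtain ⟨p, hp⟩ := b.band_pt2_zero_mem (Ioo_subset_Icc_self hy)
    obtain ⟨s₀, rfl⟩ := exists_circlePt_eq p
    obtain ⟨s₁, m, hs₁, hs₀⟩ := exists_reduce b.alo s₀
    have hper : circlePt s₀ = circlePt s₁ := by rw [circlePt_eq_circlePt_iff]; exact ⟨m, hs₀⟩
    rw [hper] at hp
    rcases le_or_gt b.ahi s₁ with h1 | h1
    · rw [← hp]; exact b.apply_A_mem_range_rebuild hAB ⟨h1, hs₁.2.le⟩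
    · -- `s₁ ∈ [alo, ahi)` is inside the lift window: contradiction with `hw`
      exfalso
      have hwin : s₁ ∈ Icc (b.thetaA 10⁻¹) (b.thetaA (9 / 10)) := ⟨by linarith [hs₁.1], by linarith⟩
      have heq := b.band_pt2_zero_heightA hwin
      rw [hp] at heq
      have hU1 : pt2 0 (b.heightA s₁) ∈ squareNhd b.δ := by
        have := (b.thetaA_heightA hwin).2
        rw [pt2_mem_squareNhd_iff]
        exact ⟨⟨by linarith [b.δ_pos], by linarith [b.δ_pos]⟩, ⟨by linarith [b.δ_pos, this.1], by linarith [b.δ_pos, this.2]⟩⟩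
      have hU2 : pt2 0 y ∈ squareNhd b.δ := by
        rw [pt2_mem_squareNhd_iff]
        exact ⟨⟨by linarith [b.δ_pos], by linarith [b.δ_pos]⟩, hy⟩
      have := b.injOn hU1 hU2 heq
      have hy' : y = b.heightA s₁ := by
        have := congrArg (fun x : 𝔼 2 ↦ x 1) this; simpa using this.symm
      exact hw (hy' ▸ (b.thetaA_heightA hwin).2)

/-- **Points of the band on the right edge at height `≤ 1/5` or `≥ 4/5` lie on the rebuilt knot.**
[folklore] -/
theorem band_pt2_one_mem_range_rebuild (hAB : Disjoint (range A) (range B)) {y : ℝ}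
    (hy : y ∈ Ioo (-b.δ) (1 + b.δ)) (h : y ≤ 1 / 5 ∨ 4 / 5 ≤ y) :
    b.band (pt2 1 y) ∈ range (b.rebuild hAB) := by
  have hanti := b.strictAntiOn_thetaB
  have hmono := hanti.antitoneOn
  have hwin' := b.thetaB_window
  by_cases hw : y ∈ Icc (10⁻¹ : ℝ) (9 / 10)
  · rw [← b.apply_circlePt_thetaB hw]
    rcases h with h | h
    · apply b.apply_B_mem_range_rebuild hAB
      refine ⟨hmono hw (by norm_num) h, ?_⟩
      have h1 : b.thetaB y ≤ b.thetaB 10⁻¹ := hmono (by norm_num) hw hw.1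
      have h2 : b.thetaB (9 / 10) ≤ b.thetaB (4 / 5) := hmono (by norm_num) (by norm_num) (by norm_num)
      linarith
    · rw [← circlePt_add_one]
      apply b.apply_B_mem_range_rebuild hAB
      have h1 : b.thetaB (9 / 10) ≤ b.thetaB y := hmono hw (by norm_num) hw.2
      have h2 : b.thetaB (1 / 5) ≤ b.thetaB 10⁻¹ := hmono (by norm_num) (by norm_num) (by norm_num)
      exact ⟨by linarith, by linarith [hmono (by norm_num) hw h]⟩
  · obtain ⟨p, hp⟩ := b.band_pt2_one_mem (Ioo_subset_Icc_self hy)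
    obtain ⟨s₀, rfl⟩ := exists_circlePt_eq p
    obtain ⟨s₁, m, hs₁, hs₀⟩ := exists_reduce (b.thetaB (1 / 5)) s₀
    have hper : circlePt s₀ = circlePt s₁ := by rw [circlePt_eq_circlePt_iff]; exact ⟨m, hs₀⟩
    rw [hper] at hp
    rcases le_or_gt s₁ (b.thetaB (4 / 5) + 1) with h1 | h1
    · rw [← hp]; exact b.apply_B_mem_range_rebuild hAB ⟨hs₁.1, h1⟩
    · exfalso
      have h82 : b.thetaB (4 / 5) < b.thetaB (1 / 5) := hanti (by norm_num) (by norm_num) (by norm_num)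
      have hwin : s₁ - 1 ∈ Icc (b.thetaB (9 / 10)) (b.thetaB 10⁻¹) := by
        constructor
        · linarith [hmono (by norm_num : (4 / 5 : ℝ) ∈ Icc (10⁻¹ : ℝ) (9 / 10)) (by norm_num) (by norm_num : (4 / 5 : ℝ) ≤ 9 / 10)]
        · linarith [hs₁.2, hmono (by norm_num : (10⁻¹ : ℝ) ∈ Icc (10⁻¹ : ℝ) (9 / 10)) (by norm_num) (by norm_num : (10⁻¹ : ℝ) ≤ 1 / 5)]
      have heq := b.band_pt2_one_heightB hwin
      rw [show circlePt (s₁ - 1) = circlePt s₁ by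
        conv_rhs => rw [show s₁ = s₁ - 1 + 1 by ring, circlePt_add_one], hp] at heq
      have hh := (b.thetaB_heightB hwin).2
      have hU1 : pt2 1 (b.heightB (s₁ - 1)) ∈ squareNhd b.δ := by
        rw [pt2_mem_squareNhd_iff]
        exact ⟨⟨by linarith [b.δ_pos], by linarith [b.δ_pos]⟩, ⟨by linarith [b.δ_pos, hh.1], by linarith [b.δ_pos, hh.2]⟩⟩
      have hU2 : pt2 1 y ∈ squareNhd b.δ := by
        rw [pt2_mem_squareNhd_iff]
        exact ⟨⟨by linarith [b.δ_pos], by linarith [b.δ_pos]⟩, hy⟩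
      have := b.injOn hU1 hU2 heq
      have hy' : y = b.heightB (s₁ - 1) := by
        have := congrArg (fun x : 𝔼 2 ↦ x 1) this; simpa using this.symm
      exact hw (hy' ▸ hh)

/-! ### Band points of the rebuilt knot are arc points -/

/-- The psi-stretch `[psi (tlo - epsLo), psi (thi + epsHi)]` is shorter than one period.
[folklore] -/
theorem psi_stretch_lt_one : b.psi (b.thi + b.epsHi) - b.psi (b.tlo - b.epsLo) < 1 := by
  obtain ⟨-, -, hε2⟩ := b.epsLo_bounds
  obtain ⟨-, -, hε2'⟩ := b.epsHi_bounds
  have h37 : b.thetaB (7 / 10) < b.thetaB (3 / 10) :=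
    b.strictAntiOn_thetaB (by norm_num) (by norm_num) (by norm_num)
  have hst := b.thetaB_stretch.2
  rw [b.psi_sub_psi]
  have e : (b.thi + b.epsHi - (b.tlo - b.epsLo)) * b.lam =
      (b.thi - b.tlo) * b.lam + (b.epsLo + b.epsHi) * b.lam := by ring
  have e2 : (b.thi - b.tlo) * b.lam = b.thetaB (4 / 5) + 1 - b.thetaB (1 / 5) := by
    have := b.psi_sub_psi b.tlo b.thi
    rw [psi_thi, psi_tlo] at this
    linarith
  rw [e, e2]
  nlinarith

/-- The marks of the `B`-zone in the window of `heightB`: `psi (tlo - epsLo) ∈ [thetaB (3/10),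
thetaB (1/5)]` and `psi (thi + epsHi) - 1 ∈ [thetaB (4/5), thetaB (7/10)]`. [folklore] -/
theorem psi_zone_marks : b.psi (b.tlo - b.epsLo) ∈ Icc (b.thetaB (3 / 10)) (b.thetaB (1 / 5)) ∧
    b.psi (b.thi + b.epsHi) - 1 ∈ Icc (b.thetaB (4 / 5)) (b.thetaB (7 / 10)) := by
  obtain ⟨hε, -, hε2⟩ := b.epsLo_bounds
  obtain ⟨hε', -, hε2'⟩ := b.epsHi_bounds
  have hl := b.lam_pos
  have e1 : b.psi (b.tlo - b.epsLo) = b.thetaB (1 / 5) - b.epsLo * b.lam := by simp only [psi]; ring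
  have e2 : b.psi (b.thi + b.epsHi) = b.thetaB (4 / 5) + 1 + b.epsHi * b.lam := by
    have := b.psi_sub_psi b.thi (b.thi + b.epsHi); rw [psi_thi] at this; linarith
  rw [e1, e2]
  exact ⟨⟨by nlinarith, by nlinarith⟩, ⟨by nlinarith, by nlinarith⟩⟩

/-- **A band point of the rebuilt knot inside the collar is a point of one of the two arches**
(over their stretches). [folklore] -/
theorem mem_arches_of_band_mem_range (hAB : Disjoint (range A) (range B)) {x : 𝔼 2}
    (hx : x ∈ squareNhd b.δ) (h : b.band x ∈ range (b.rebuild hAB)) :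
    x ∈ b.cLo '' Ioo b.tstarLo b.tendLo ∪ b.cUp '' Ioo b.tstarUp b.tendUp := by
  have hm := b.marks_lt
  have hδ := b.δ_pos
  obtain ⟨hε, hε1, -⟩ := b.epsLo_bounds
  obtain ⟨hε', hε1', -⟩ := b.epsHi_bounds
  have ho := b.lo_order
  have ho' := b.up_order
  obtain ⟨s, hs, hps⟩ := (b.mem_range_rebuild_iff hAB).1 h
  have hxU := hx
  rw [mem_squareNhd_iff, Fin.forall_fin_two] at hx
  rcases b.kind_cases s with hk | hk | hk | hk
  · -- the point is on `A`: `x = (0, y)`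
    rw [b.pieceFun_typeA hs hk, Knot.curve_apply] at hps
    have hxA : x ∈ b.band ⁻¹' range A ∩ squareNhd b.δ := ⟨⟨_, Subtype.ext hps⟩, hxU⟩
    rw [b.preimage_left] at hxA
    set y := x 1 with hy
    have hxe : x = pt2 0 y := by
      ext i; fin_cases i
      · simpa using hxA.2
      · simp [hy]
    rcases le_or_gt y (b.fLo (b.alo + b.epsLo)) with h1 | h1
    · -- on the climbing part of the lower arch
      left
      obtain ⟨t, ht, hty⟩ : y ∈ b.fLo '' Icc b.tstarLo (b.alo + b.epsLo) :=
        intermediate_value_Icc (by linarith) b.fLo_spec.1.continuous.continuousOn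
          ⟨by rw [b.tstarLo_spec.2]; exact hx.2.1.le, h1⟩
      have hne : t ≠ b.tstarLo := by
        rintro rfl; rw [b.tstarLo_spec.2] at hty; linarith [hx.2.1]
      refine ⟨t, ⟨lt_of_le_of_ne ht.1 (Ne.symm hne), by linarith [ht.2]⟩, ?_⟩
      rw [b.cLo_spec.2.1 t ht.2, hty, hxe]
    rcases le_or_gt (b.fUp (b.ahi - b.epsHi)) y with h2 | h2
    · -- on the climbing part of the upper arch
      right
      obtain ⟨t, ht, hty⟩ : y ∈ b.fUp '' Icc (b.ahi - b.epsHi) b.tendUp :=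
        intermediate_value_Icc (by linarith) b.fUp_spec.1.continuous.continuousOn
          ⟨h2, by rw [b.tendUp_spec.2]; exact hx.2.2.le⟩
      have hne : t ≠ b.tendUp := by
        rintro rfl; rw [b.tendUp_spec.2] at hty; linarith [hx.2.2]
      refine ⟨t, ⟨by linarith [ht.1], lt_of_le_of_ne ht.2 hne⟩, ?_⟩
      rw [b.cUp_eq_left ht.1, hty, hxe]
    · -- in between: the parameter of `A` would lie strictly inside `(alo + ε, ahi - ε')`
      exfalso
      obtain ⟨hfl, hfl'⟩ := b.fLo_eq_heightA (t := b.alo + b.epsLo) ⟨by linarith, by linarith⟩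
      obtain ⟨hfu, hfu'⟩ := b.fUp_eq_heightA (t := b.ahi - b.epsHi) ⟨by linarith, by linarith⟩
      rw [hfl] at h1
      rw [hfu] at h2
      have hyw : y ∈ Icc (10⁻¹ : ℝ) (9 / 10) := ⟨by linarith [hfl'.1], by linarith [hfu'.2]⟩
      have hwin1 : b.alo + b.epsLo ∈ Icc (b.thetaA 10⁻¹) (b.thetaA (9 / 10)) := ⟨by linarith, by linarith⟩
      have hwin2 : b.ahi - b.epsHi ∈ Icc (b.thetaA 10⁻¹) (b.thetaA (9 / 10)) := ⟨by linarith, by linarith⟩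
      have ht1 : b.alo + b.epsLo < b.thetaA y := by
        have := b.strictMonoOn_thetaA (b.thetaA_heightA hwin1).2 hyw h1
        rwa [(b.thetaA_heightA hwin1).1] at this
      have ht2 : b.thetaA y < b.ahi - b.epsHi := by
        have := b.strictMonoOn_thetaA hyw (b.thetaA_heightA hwin2).2 h2
        rwa [(b.thetaA_heightA hwin2).1] at this
      have heq : A (circlePt (b.thetaA y)) = A (circlePt s) := by
        rw [b.apply_circlePt_thetaA hyw, ← hxe]; exact Subtype.ext hps.symm
      obtain ⟨m, hm'⟩ := circlePt_eq_circlePt_iff.1 (A.injective heq)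
      rcases lt_trichotomy m 0 with hm0 | hm0 | hm0
      · have : (m : ℝ) ≤ -1 := by exact_mod_cast Int.le_sub_one_of_lt hm0
        linarith [hs.2]
      · rw [hm0, Int.cast_zero, add_zero] at hm'
        rcases hk with hk | hk <;> linarith
      · have : (1 : ℝ) ≤ m := by exact_mod_cast hm0
        linarith [hs.1]
  · -- the point is on `B`: `x = (1, y)`
    rw [b.pieceFun_typeB hk, Knot.curve_apply] at hps
    have hxB : x ∈ b.band ⁻¹' range B ∩ squareNhd b.δ := ⟨⟨_, Subtype.ext hps⟩, hxU⟩
    rw [b.preimage_right] at hxB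
    set y := x 1 with hy
    have hxe : x = pt2 1 y := by
      ext i; fin_cases i
      · simpa using hxB.2
      · simp [hy]
    have hw := b.tlo_marksB
    have hw' := b.thi_marksB
    rcases le_or_gt y (b.gLo (b.tlo - b.epsLo)) with h1 | h1
    · -- on the descending part of the lower arch
      left
      obtain ⟨t, ht, hty⟩ : y ∈ b.gLo '' Icc (b.tlo - b.epsLo) b.tendLo :=
        intermediate_value_Icc' (by linarith) b.gLo_spec.1.continuous.continuousOn
          ⟨by rw [b.tendLo_spec.2]; exact hx.2.1.le, h1⟩
      have hne : t ≠ b.tendLo := by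
        rintro rfl; rw [b.tendLo_spec.2] at hty; linarith [hx.2.1]
      refine ⟨t, ⟨by linarith [ht.1], lt_of_le_of_ne ht.2 hne⟩, ?_⟩
      rw [b.cLo_spec.2.2.1 t ht.1, hty, hxe]
    rcases le_or_gt (b.gUp (b.thi + b.epsHi)) y with h2 | h2
    · -- on the descending part of the upper arch
      right
      obtain ⟨t, ht, hty⟩ : y ∈ b.gUp '' Icc b.tstarUp (b.thi + b.epsHi) :=
        intermediate_value_Icc' (by linarith) b.gUp_spec.1.continuous.continuousOn
          ⟨h2, by rw [b.tstarUp_spec.2]; exact hx.2.2.le⟩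
      have hne : t ≠ b.tstarUp := by
        rintro rfl; rw [b.tstarUp_spec.2] at hty; linarith [hx.2.2]
      refine ⟨t, ⟨lt_of_le_of_ne ht.1 (Ne.symm hne), by linarith [ht.2]⟩, ?_⟩
      rw [b.cUp_eq_right ht.2, hty, hxe]
    · -- in between: the parameter of `B` would lie strictly inside the stretch
      exfalso
      obtain ⟨hz1, hz2⟩ := b.psi_zone_marks
      have hg1 : b.gLo (b.tlo - b.epsLo) = b.heightB (b.psi (b.tlo - b.epsLo)) :=
        b.gLo_spec.2.1 _ ⟨hw.2, by linarith [hw.1]⟩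
      have hg2 : b.gUp (b.thi + b.epsHi) = b.heightB (b.psi (b.thi + b.epsHi) - 1) :=
        b.gUp_spec.2.1 _ ⟨by linarith [hw'.1], by linarith [hw'.2]⟩
      rw [hg1] at h1
      rw [hg2] at h2
      have hanti := b.strictAntiOn_thetaB
      have hmono := hanti.antitoneOn
      have hwin1 : b.psi (b.tlo - b.epsLo) ∈ Icc (b.thetaB (9 / 10)) (b.thetaB 10⁻¹) :=
        ⟨by linarith [hz1.1, hmono (by norm_num : (3 / 10 : ℝ) ∈ Icc (10⁻¹ : ℝ) (9 / 10)) (by norm_num) (by norm_num : (3 / 10 : ℝ) ≤ 9 / 10)],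
          by linarith [hz1.2, hmono (by norm_num : (10⁻¹ : ℝ) ∈ Icc (10⁻¹ : ℝ) (9 / 10)) (by norm_num) (by norm_num : (10⁻¹ : ℝ) ≤ 1 / 5)]⟩
      have hwin2 : b.psi (b.thi + b.epsHi) - 1 ∈ Icc (b.thetaB (9 / 10)) (b.thetaB 10⁻¹) :=
        ⟨by linarith [hz2.1, hmono (by norm_num : (4 / 5 : ℝ) ∈ Icc (10⁻¹ : ℝ) (9 / 10)) (by norm_num) (by norm_num : (4 / 5 : ℝ) ≤ 9 / 10)],
          by linarith [hz2.2, hmono (by norm_num : (10⁻¹ : ℝ) ∈ Icc (10⁻¹ : ℝ) (9 / 10)) (by norm_num) (by norm_num : (10⁻¹ : ℝ) ≤ 7 / 10)]⟩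
      obtain ⟨e1, hh1⟩ := b.thetaB_heightB hwin1
      obtain ⟨e2, hh2⟩ := b.thetaB_heightB hwin2
      -- `heightB` of the zone marks lies in `[1/5, 3/10]` resp. `[7/10, 4/5]`
      have hb1 : (1 / 5 : ℝ) ≤ b.heightB (b.psi (b.tlo - b.epsLo)) := by
        rw [← b.heightB_thetaB (y := 1 / 5) (by norm_num)]
        exact b.strictAntiOn_heightB.antitoneOn hwin1 ⟨by linarith [hanti (by norm_num) (by norm_num) (by norm_num : (1 / 5 : ℝ) < 9 / 10)], hmono (by norm_num) (by norm_num) (by norm_num : (10⁻¹ : ℝ) ≤ 1 / 5)⟩ hz1.2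
      have hb2 : b.heightB (b.psi (b.thi + b.epsHi) - 1) ≤ 4 / 5 := by
        rw [← b.heightB_thetaB (y := 4 / 5) (by norm_num)]
        exact b.strictAntiOn_heightB.antitoneOn ⟨hmono (by norm_num) (by norm_num) (by norm_num : (4 / 5 : ℝ) ≤ 9 / 10), by linarith [hanti (by norm_num) (by norm_num) (by norm_num : (10⁻¹ : ℝ) < 4 / 5)]⟩ hwin2 hz2.1
      have hyw : y ∈ Icc (10⁻¹ : ℝ) (9 / 10) := ⟨by linarith, by linarith⟩
      have ht1 : b.thetaB y < b.psi (b.tlo - b.epsLo) := by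
        have := hanti hh1 hyw h1; rwa [e1] at this
      have ht2 : b.psi (b.thi + b.epsHi) - 1 < b.thetaB y := by
        have := hanti hyw hh2 h2; rwa [e2] at this
      have heq : B (circlePt (b.thetaB y)) = B (circlePt (b.psi s)) := by
        rw [b.apply_circlePt_thetaB hyw, ← hxe]; exact Subtype.ext hps.symm
      obtain ⟨m, hm'⟩ := circlePt_eq_circlePt_iff.1 (B.injective heq)
      have hps1 := b.strictMono_psi.monotone hk.1
      have hps2 := b.strictMono_psi.monotone hk.2
      have hL := b.psi_stretch_lt_one
      rcases lt_trichotomy m 0 with hm0 | hm0 | hm0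
      · have : (m : ℝ) ≤ -1 := by exact_mod_cast Int.le_sub_one_of_lt hm0
        nlinarith
      · rw [hm0, Int.cast_zero, add_zero] at hm'
        linarith
      · have : (1 : ℝ) ≤ m := by exact_mod_cast hm0
        linarith
  · -- a band point of the lower arch
    left
    obtain ⟨he, hU, -, -, -, -⟩ := b.pieceFun_typeO_lo hk
    rw [he] at hps
    have := b.injOn hU hxU (Subtype.ext hps)
    exact ⟨s, ⟨by linarith [hk.1], by linarith [hk.2]⟩, this⟩
  · -- a band point of the upper arch
    right
    obtain ⟨he, hU, -, -, -, -⟩ := b.pieceFun_typeO_hi hk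
    rw [he] at hps
    have := b.injOn hU hxU (Subtype.ext hps)
    exact ⟨s, ⟨by linarith [hk.1], by linarith [hk.2]⟩, this⟩

/-- **Every point of the lower arch over its stretch is a band point of the rebuilt knot.**
[folklore] -/
theorem band_cLo_mem_range (hAB : Disjoint (range A) (range B)) {t : ℝ} (ht : t ∈ Ioo b.tstarLo b.tendLo) :
    b.band (b.cLo t) ∈ range (b.rebuild hAB) := by
  have hm := b.marks_lt
  obtain ⟨hε, hε1, -⟩ := b.epsLo_bounds
  have ho := b.lo_order
  obtain ⟨hU, hx1⟩ := b.cLo_mem_of_mem_Ioo ht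
  rcases lt_or_ge t b.alo with h1 | h1
  · -- climbing part: a point of the left edge at height `< 1/5`
    have hform := b.cLo_spec.2.1 t (by linarith)
    rw [hform]
    rw [hform, pt2_apply_one] at hx1
    apply b.band_pt2_zero_mem_range_rebuild hAB ⟨hx1.1, by linarith [hx1.2, b.δ_pos]⟩
    left
    have := b.strictMonoOn_fLo (show t ∈ Iic _ by simp only [mem_Iic]; linarith)
      (show b.alo ∈ Iic _ by simp only [mem_Iic]; linarith) h1
    rw [(b.fLo_eq_heightA (t := b.alo) ⟨by linarith, by linarith⟩).1, b.heightA_marks.1] at this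
    exact this.le
  rcases lt_or_ge t b.tlo with h2 | h2
  · rw [b.mem_range_rebuild_iff hAB]
    exact ⟨t, ⟨h1, by linarith⟩, b.pieceFun_of_lt_tlo h2⟩
  · -- descending part: a point of the right edge at height `≤ 1/5`
    have hform := b.cLo_spec.2.2.1 t (by linarith)
    rw [hform]
    rw [hform, pt2_apply_one] at hx1
    apply b.band_pt2_one_mem_range_rebuild hAB ⟨hx1.1, by linarith [hx1.2, b.δ_pos]⟩
    left
    have hw := b.tlo_marksB
    have := b.strictAntiOn_gLo.antitoneOn (show b.tlo ∈ Ici _ by simp only [mem_Ici]; linarith)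
      (show t ∈ Ici _ by simp only [mem_Ici]; linarith) h2
    rw [b.gLo_spec.2.1 b.tlo ⟨by linarith [hw.2], hw.1.le⟩, psi_tlo, b.heightB_thetaB (by norm_num)] at this
    exact this

/-- **Every point of the upper arch over its stretch is a band point of the rebuilt knot.**
[folklore] -/
theorem band_cUp_mem_range (hAB : Disjoint (range A) (range B)) {t : ℝ} (ht : t ∈ Ioo b.tstarUp b.tendUp) :
    b.band (b.cUp t) ∈ range (b.rebuild hAB) := by
  have hm := b.marks_lt
  obtain ⟨hε, hε1, -⟩ := b.epsHi_bounds
  have ho := b.up_order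
  have hw := b.thi_marksB
  obtain ⟨hU, hx1⟩ := b.cUp_mem_of_mem_Ioo ht
  rcases le_or_gt t b.thi with h1 | h1
  · -- descending part near `B`: a point of the right edge at height `≥ 4/5`
    have hform := b.cUp_eq_right (t := t) (by linarith)
    rw [hform]
    rw [hform, pt2_apply_one] at hx1
    apply b.band_pt2_one_mem_range_rebuild hAB ⟨by linarith [hx1.1, b.δ_pos], hx1.2⟩
    right
    have := b.strictAntiOn_gUp.antitoneOn (show t ∈ Iic _ by simp only [mem_Iic]; linarith)
      (show b.thi ∈ Iic _ by simp only [mem_Iic]; linarith) h1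
    rw [b.gUp_spec.2.1 b.thi ⟨hw.1.le, by linarith [hw.2]⟩, psi_thi, add_sub_cancel_right,
      b.heightB_thetaB (by norm_num)] at this
    exact this
  rcases lt_or_ge t b.ahi with h2 | h2
  · rw [b.mem_range_rebuild_iff hAB]
    exact ⟨t, ⟨by linarith, by linarith⟩, b.pieceFun_of_thi_le h1.le h2⟩
  · -- climbing part near `A`: a point of the left edge at height `≥ 4/5`
    have hform := b.cUp_eq_left (t := t) (by linarith)
    rw [hform]
    rw [hform, pt2_apply_one] at hx1
    apply b.band_pt2_zero_mem_range_rebuild hAB ⟨by linarith [hx1.1, b.δ_pos], hx1.2⟩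
    right
    have := b.strictMonoOn_fUp.monotoneOn (show b.ahi ∈ Ici _ by simp only [mem_Ici]; linarith)
      (show t ∈ Ici _ by simp only [mem_Ici]; linarith) h2
    rw [(b.fUp_eq_heightA (t := b.ahi) ⟨by linarith, by linarith⟩).1, b.heightA_marks.2.2.2] at this
    exact this

/-- **The range clause** of the rebuilt presentation. [folklore] -/
theorem preimage_range_rebuild (hAB : Disjoint (range A) (range B)) :
    b.band ⁻¹' range (b.rebuild hAB) ∩ squareNhd b.δ = b.loArc '' Ioo 0 1 ∪ b.upArc '' Ioo 0 1 := by
  rw [image_loArc, image_upArc]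
  ext x
  constructor
  · rintro ⟨hx, hU⟩
    exact b.mem_arches_of_band_mem_range hAB hU hx
  · rintro (⟨t, ht, rfl⟩ | ⟨t, ht, rfl⟩)
    · exact ⟨b.band_cLo_mem_range hAB ht, (b.cLo_mem_of_mem_Ioo ht).1⟩
    · exact ⟨b.band_cUp_mem_range hAB ht, (b.cUp_mem_of_mem_Ioo ht).1⟩

/-- **The complement clause**: off the band the rebuilt knot is `A ∪ B`. [folklore] -/
theorem range_diff_rebuild (hAB : Disjoint (range A) (range B)) :
    range (b.rebuild hAB) \ b.band '' squareNhd b.δ = (range A ∪ range B) \ b.band '' squareNhd b.δ := by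
  have hm := b.marks_lt
  have hδ := b.δ_pos
  ext p
  simp only [Set.mem_sdiff, mem_union]
  constructor
  · rintro ⟨hp, hnot⟩
    refine ⟨?_, hnot⟩
    obtain ⟨s, hs, hps⟩ := (b.mem_range_rebuild_iff hAB).1 hp
    rcases b.kind_cases s with hk | hk | hk | hk
    · rw [b.pieceFun_typeA hs hk, Knot.curve_apply] at hps
      exact Or.inl ⟨_, Subtype.ext hps⟩
    · rw [b.pieceFun_typeB hk, Knot.curve_apply] at hps
      exact Or.inr ⟨_, Subtype.ext hps⟩
    · obtain ⟨he, hU, -, -, -, -⟩ := b.pieceFun_typeO_lo hk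
      rw [he] at hps
      exact absurd ⟨_, hU, Subtype.ext hps⟩ hnot
    · obtain ⟨he, hU, -, -, -, -⟩ := b.pieceFun_typeO_hi hk
      rw [he] at hps
      exact absurd ⟨_, hU, Subtype.ext hps⟩ hnot
  · rintro ⟨hp | hp, hnot⟩ <;> refine ⟨?_, hnot⟩
    · obtain ⟨q, rfl⟩ := hp
      obtain ⟨s₀, rfl⟩ := exists_circlePt_eq q
      obtain ⟨s₁, m, hs₁, hs₀⟩ := exists_reduce b.alo s₀
      have hper : circlePt s₀ = circlePt s₁ := by rw [circlePt_eq_circlePt_iff]; exact ⟨m, hs₀⟩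
      rw [hper] at hnot ⊢
      rcases le_or_gt b.ahi s₁ with h1 | h1
      · exact b.apply_A_mem_range_rebuild hAB ⟨h1, hs₁.2.le⟩
      · exfalso
        have hwin : s₁ ∈ Icc (b.thetaA 10⁻¹) (b.thetaA (9 / 10)) := ⟨by linarith [hs₁.1], by linarith⟩
        have hh := (b.thetaA_heightA hwin).2
        refine hnot ⟨pt2 0 (b.heightA s₁), ?_, b.band_pt2_zero_heightA hwin⟩
        rw [pt2_mem_squareNhd_iff]
        exact ⟨⟨by linarith, by linarith⟩, ⟨by linarith [hh.1], by linarith [hh.2]⟩⟩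
    · obtain ⟨q, rfl⟩ := hp
      obtain ⟨s₀, rfl⟩ := exists_circlePt_eq q
      obtain ⟨s₁, m, hs₁, hs₀⟩ := exists_reduce (b.thetaB (1 / 5)) s₀
      have hper : circlePt s₀ = circlePt s₁ := by rw [circlePt_eq_circlePt_iff]; exact ⟨m, hs₀⟩
      rw [hper] at hnot ⊢
      have hanti := b.strictAntiOn_thetaB
      have hmono := hanti.antitoneOn
      rcases le_or_gt s₁ (b.thetaB (4 / 5) + 1) with h1 | h1
      · exact b.apply_B_mem_range_rebuild hAB ⟨hs₁.1, h1⟩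
      · exfalso
        have hwin : s₁ - 1 ∈ Icc (b.thetaB (9 / 10)) (b.thetaB 10⁻¹) := by
          constructor
          · linarith [hmono (by norm_num : (4 / 5 : ℝ) ∈ Icc (10⁻¹ : ℝ) (9 / 10)) (by norm_num) (by norm_num : (4 / 5 : ℝ) ≤ 9 / 10)]
          · linarith [hs₁.2, hmono (by norm_num : (10⁻¹ : ℝ) ∈ Icc (10⁻¹ : ℝ) (9 / 10)) (by norm_num) (by norm_num : (10⁻¹ : ℝ) ≤ 1 / 5)]
        have hh := (b.thetaB_heightB hwin).2
        refine hnot ⟨pt2 1 (b.heightB (s₁ - 1)), ?_, ?_⟩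
        · rw [pt2_mem_squareNhd_iff]
          exact ⟨⟨by linarith, by linarith⟩, ⟨by linarith [hh.1], by linarith [hh.2]⟩⟩
        · rw [b.band_pt2_one_heightB hwin]
          conv_rhs => rw [show s₁ = s₁ - 1 + 1 by ring, circlePt_add_one]

/-! ### The orientation clause along the lower arc -/

/-- **Orientation of the rebuilt knot along the lower arc**: at the midpoint `loArc (1/2) =
cLo ((alo + tlo)/2)` the rebuilt knot is parametrised by `band ∘ cLo` itself (up to the positive
factors `2π` and `rhoLo' (1/2)`). [folklore] -/
theorem orient_result_rebuild (hAB : Disjoint (range A) (range B)) :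
    ∃ θ c : ℝ, 0 < c ∧ b.rebuild hAB (circlePoint θ) = b.band (b.loArc 2⁻¹) ∧
      deriv (fun t ↦ ((b.rebuild hAB (circlePoint t) : 𝕊 3) : 𝔼 4)) θ =
        c • fderiv ℝ (fun x ↦ ((b.band x : 𝕊 3) : 𝔼 4)) (b.loArc 2⁻¹) (deriv b.loArc 2⁻¹) := by
  have ho := b.lo_order
  set tm := (b.alo + b.tlo) / 2 with htm
  have htm' : tm ∈ Ioo b.alo b.tlo := ⟨ho.2.2.1, ho.2.2.2.1⟩
  have hρ := b.rhoLo_spec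
  set r := deriv b.rhoLo 2⁻¹ with hr
  have hrpos : 0 < r := hρ.2.2.2.2.1 _
  refine ⟨2 * π * tm, ((2 * π)⁻¹) * r⁻¹, mul_pos (inv_pos.2 (by positivity)) (inv_pos.2 hrpos), ?_, ?_⟩
  · apply Subtype.ext
    rw [← circlePt_eq_circlePoint, b.coe_rebuild_circlePt, loArc_half,
      (b.rebuildCurve_eventuallyEq_lo htm').self_of_nhds]
  · -- the knot through `circlePoint` is the rebuilt curve at `t / 2π`
    have hfun : (fun t ↦ ((b.rebuild hAB (circlePoint t) : 𝕊 3) : 𝔼 4)) =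
        fun t ↦ b.rebuildCurve ((2 * π)⁻¹ * t) := by
      funext t
      rw [rebuild, IsRegularClosedCurve.coe_toKnot_circlePoint]
    rw [hfun, deriv_comp_mul_left (2 * π)⁻¹ b.rebuildCurve, ← mul_assoc,
      inv_mul_cancel₀ (by positivity : (2 * π : ℝ) ≠ 0), one_mul]
    -- derivative of the rebuilt curve at `tm` through the local representation
    rw [(b.rebuildCurve_eventuallyEq_lo htm').deriv_eq]
    have hband : HasDerivAt (fun t ↦ ((b.band (b.cLo t) : 𝕊 3) : 𝔼 4))
        (fderiv ℝ (fun x ↦ ((b.band x : 𝕊 3) : 𝔼 4)) (b.cLo tm) (deriv b.cLo tm)) tm :=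
      ((b.contDiff_coe_band.differentiable (by simp)) _).hasFDerivAt.comp_hasDerivAt tm
        ((b.cLo_spec.1.differentiable (by simp)) _).hasDerivAt
    rw [hband.deriv, loArc_half, show b.loArc = fun u ↦ b.cLo (b.rhoLo u) from rfl,
      deriv_comp_reparam b.cLo_spec.1 hρ.1, hρ.2.2.1, map_smul, smul_smul, ← hr,
      mul_assoc, inv_mul_cancel₀ hrpos.ne', mul_one]

/-! ### The rebuilt presentation -/

/-- **The rebuilt knot is a band sum of `A` and `B` along the same band, with the same collar
width, and the standard arcs.** [folklore] -/
def rebuildData (b : BandData A B K ∅) (hAB : Disjoint (range A) (range B)) :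
    BandData A B (b.rebuild hAB) ∅ where
  band := b.band
  δ := b.δ
  δ_pos := b.δ_pos
  contMDiff := b.contMDiff
  injOn := b.injOn
  injective_mfderiv := b.injective_mfderiv
  disjoint_avoid := disjoint_empty _
  preimage_left := b.preimage_left
  preimage_right := b.preimage_right
  range_diff := b.range_diff_rebuild hAB
  lowerArc := b.loArc
  upperArc := b.upArc
  contDiff_lowerArc := b.contDiff_loArc
  contDiff_upperArc := b.contDiff_upArc
  injOn_lowerArc := b.injective_loArc.injOn
  injOn_upperArc := b.injective_upArc.injOn
  deriv_lowerArc_ne_zero t _ := b.deriv_loArc_ne_zero t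
  deriv_upperArc_ne_zero t _ := b.deriv_upArc_ne_zero t
  lowerArc_zero := b.loArc_zero
  lowerArc_one := b.loArc_one
  upperArc_zero := b.upArc_zero
  upperArc_one := b.upArc_one
  lowerArc_mem _ ht := b.loArc_mem ht
  upperArc_mem _ ht := b.upArc_mem ht
  preimage_range := b.preimage_range_rebuild hAB
  orient_left := b.orient_left
  orient_right := b.orient_right
  orient_result := b.orient_result_rebuild hAB

/-- The rebuilt presentation has the same band. [folklore] -/
@[simp] theorem rebuildData_band (b : BandData A B K ∅) (hAB : Disjoint (range A) (range B)) :
    (b.rebuildData hAB).band = b.band := rfl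

/-- The rebuilt presentation has the same collar width. [folklore] -/
@[simp] theorem rebuildData_δ (b : BandData A B K ∅) (hAB : Disjoint (range A) (range B)) :
    (b.rebuildData hAB).δ = b.δ := rfl

/-- **A band sum is isotopic to its rebuilt form**, granted that band sums depend only on the band
(`BandData.isIsotopic_of_band_eq`, `BandSum.lean`). [folklore] -/
theorem isIsotopic_rebuild (hfact : BandData.isIsotopic_of_band_eq) (b : BandData A B K ∅)
    (hAB : Disjoint (range A) (range B)) : K.IsIsotopic (b.rebuild hAB) :=
  hfact b (b.rebuildData hAB) rfl rfl

end BandData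

namespace Knot

/-- A knot in the open northern hemisphere and a knot in the open southern hemisphere are
disjoint. [folklore] -/
theorem disjoint_range_of_inNorth_inSouth {A B : Knot} (hA : A.InNorth) (hB : B.InSouth) :
    Disjoint (range A) (range B) := by
  rw [Set.disjoint_left]
  rintro _ ⟨x, rfl⟩ ⟨y, hy⟩
  have h1 := hA x
  have h2 := hB y
  rw [hy] at h2
  exact lt_asymm h1 h2

/-- **Schubert's theorem for rebuilt presentations in normal position** (the remaining geometric
heart of `IsConnectedSum.isIsotopic`). Let `A` be an oriented knot in the open northern and `B` one
in the open southern hemisphere of `𝕊³`, and let `b : BandData A B K ∅`, `b' : BandData A B K' ∅`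
be two band-sum presentations whose bands cross the equatorial sphere exactly in their middle
lines. Then the two *rebuilt* knots `b.rebuild _` and `b'.rebuild _` (`BandRebuildCurve.lean`:
`A` and `B` joined through the respective band by the standard arches of
`BandRebuildArches.lean`, each a band sum of `A`, `B` along that band, `BandData.rebuildData`) are
isotopic. This is the special case of Cromwell (2004), Thm. 4.6.1 / §4.6 (PDF p. 69) — the
product `L₁ # L₂ = (L₁ - a) ∪ (L₂ - c) ∪ b ∪ d` of oriented knots formed from a split link is
independent of the rectangular disc `R` — for the two explicit discs `R = b.band (D)`,
`R' = b'.band (D')`, where `D ⊆ [0, 1] × [1/10, 9/10]` is the planar region bounded by the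
left-edge segment `{0} × [1/5, 4/5]` (`= band⁻¹ a`, on `A`), the lower arch `b.cLo`, the
right-edge segment `{1} × [1/5, 4/5]` (on `B`) and the upper arch `b.cUp` (closed embedded discs,
the band being an embedding on this part of the collar, meeting the separating sphere in the
middle line `x₀ = 1/2`; the rebuilt knot is exactly `(A - a) ∪ (B - c) ∪ band (cLo) ∪ band (cUp)`),
with the factors `A`, `B` and the separating sphere fixed; due to H. Schubert (1949), Satz 3 (not
held; cf. Burde–Zieschang (2003), §7.A). Its classical proof (slide the attaching arcs along `A` and `B`,
absorb twists of the band into rotations of the southern ball, retract the `B`-side along the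
band undoing linking and local knotting, uniqueness of the ball–arc pair of a knot) is not
formalised here. Named fact (statement only). [cite: Cromwell2004, §4.6 (PDF p. 69)] -/
def Schubert1949_normalPosition_rebuilt : Prop :=
  ∀ {A B K K' : Knot} (b : BandData A B K ∅) (b' : BandData A B K' ∅) (hA : A.InNorth) (hB : B.InSouth),
    b.band ⁻¹' sphereEquator 2 ∩ squareNhd b.δ = {x ∈ squareNhd b.δ | x 0 = 2⁻¹} →
    b'.band ⁻¹' sphereEquator 2 ∩ squareNhd b'.δ = {x ∈ squareNhd b'.δ | x 0 = 2⁻¹} →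
    (b.rebuild (disjoint_range_of_inNorth_inSouth hA hB)).IsIsotopic
      (b'.rebuild (disjoint_range_of_inNorth_inSouth hA hB))

/-- **Reduction of Schubert's theorem in normal position to rebuilt presentations.** Granted that
a band sum depends only on its band (`hfact`, `BandData.isIsotopic_of_band_eq` of `BandSum.lean`,
Gompf–Stipsicz (1999), §5.1) and Schubert's theorem for rebuilt presentations (`hR`), Schubert's
theorem holds for all presentations in normal position: `K ≃ b.rebuild ≃ b'.rebuild ≃ K'`, the
outer isotopies by `BandData.isIsotopic_rebuild` (`K` and `b.rebuild` are band sums along the same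
band with the same collar width, `BandData.rebuildData`). Cromwell (2004), §4.6.
[cite: Cromwell2004, §4.6 (PDF p. 69)] -/
theorem Schubert1949_normalPosition_of_rebuilt (hfact : BandData.isIsotopic_of_band_eq)
    (hR : Schubert1949_normalPosition_rebuilt) : Schubert1949_normalPosition := by
  intro A B K K' b b' hA hB hcross hcross'
  have hAB := disjoint_range_of_inNorth_inSouth hA hB
  have h1 : K.IsIsotopic (b.rebuild hAB) := b.isIsotopic_rebuild hfact hAB
  have h2 : K'.IsIsotopic (b'.rebuild hAB) := b'.isIsotopic_rebuild hfact hAB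
  have h3 : (b.rebuild hAB).IsIsotopic (b'.rebuild hAB) := hR b b' hA hB hcross hcross'
  exact IsAmbientIsotopic.trans_holds (IsAmbientIsotopic.trans_holds h1 h3) (IsAmbientIsotopic.symm_holds h2)

/-- **The connected sum of oriented knots is well defined, reduced to three named facts**: the
ball form of the smooth Schoenflies theorem in `𝕊³` (`hB`, Alexander (1924);
`SchoenfliesSphereThree.lean`), band sums depend only on the band (`hfact`, Gompf–Stipsicz (1999),
§5.1; `BandSum.lean`), and Schubert's theorem for rebuilt presentations in normal position (`hR`,
this file). Assembles `IsConnectedSum.isIsotopic_of_ball_of_normalPosition`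
(`SchoenfliesIsotopy.lean`) with `Schubert1949_normalPosition_of_rebuilt`. Cromwell (2004), §4.6,
Thm. 4.6.1. [cite: Cromwell2004, §4.6 (PDF p. 69)] -/
theorem IsConnectedSum.isIsotopic_of_ball_of_band_eq_of_rebuilt
    (hB : SphereEmbedding.schoenflies_exists_ball) (hfact : BandData.isIsotopic_of_band_eq)
    (hR : Schubert1949_normalPosition_rebuilt) : IsConnectedSum.isIsotopic :=
  IsConnectedSum.isIsotopic_of_ball_of_normalPosition hB (Schubert1949_normalPosition_of_rebuilt hfact hR)

end Knot

end Literature.Topology.FourManifolds
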